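import Literature.AlgebraicGeometry.Resolution.RoofDatum
import Literature.AlgebraicGeometry.Resolution.ConjugateBoundCoefficients
import HarnessLib

/-!
# The disc-coordinate Hensel polynomial: Taylor form at the centre and membership in the disc chart

Topic: `Literature/AlgebraicGeometry/Resolution`. M. Temkin, *Inseparable local uniformization*,
J. Algebra 373 (2013) = arXiv:0804.1554v3, Thm. 3.3.1, smooth-fibre case (tree:
`Temkin2013RelativeCurveSmoothFibre`), driver of the roof construction (`RoofDatum.lean`): the
second `K`-side chart is cut out by `H(S) = P(x − cS)/(−c P′(x))` (`discHenselPoly`), and the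
E-side needs `H′(x′) ∈ T_B` and the coefficients `h_j ∈ B = m°[x′][1/u]`. Writing
`P(a + T) = T·Q(T)` (`a` a simple root), `Q = ∏_{ρ ≠ a} (T − (ρ − a))`, the coefficients satisfy
`|q_k| |c|ᵏ ≤ |q₀| = |P′(a)|` when `|c| ≤ |ρ − a|` for all roots `ρ ≠ a` (elementary symmetric
functions against the complementary product), so

* `P′(x) = P′(a) · U(x′)` with `U = (Q_c + X Q_c′)/P′(a)`, `Q_c(X) = Q(cX)`, a UNIT FORM over `m`
  (`U(0) = 1`, higher coefficients in `m` of value `< 1`) when the roots are strictly far;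
* `H · U(x′) = −(x′ − X) · Q̃(x′ − X)` with `Q̃ = Q_c / P′(a)` having coefficients in `m°`;
* hence **every coefficient of `H` lies in `m°[x′][1/u]` as soon as `U(x′) ∣ u`**.

Results: `valuation_esymm_mul_pow_le_prod` (the symmetric-function bound), `taylorQuot` API
(`X_mul_taylorQuot`, `taylorQuot_eq_prod_roots`, `eval_zero_taylorQuot`,
`valuation_coeff_taylorQuot_mul_pow_le`), `exists_unitForm_derivative_and_coeff_mem` (the
package consumed by the driver). All [folklore]; the only definition is the abbreviation
`(P.comp (X + C a)).divX := (P.comp (X + C a)).divX`.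

## Sources

* M. Temkin, arXiv:0804.1554v3, Lemma 3.1.3 and proof of Thm. 3.3.1, Step 3. [Temkin2013]
-/

noncomputable section

open Polynomial

namespace Literature.AlgebraicGeometry.Resolution

universe u

variable {Ω : Type u} [Field Ω] (V : ValuationSubring Ω)

/-! ### Elementary symmetric functions against the complementary product -/

section Esymm

/-- **`|e_k(S)| · r^{n−k} ≤ |∏ S|`** for a multiset `S` of `n` elements all of value `≥ r` and
`k ≤ n`: each term `∏ T` (`T ⊆ S`, `|T| = k`) times `r^{n−k}` is at most `|∏ T| |∏ (S ∖ T)|`.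
[folklore] -/
theorem valuation_esymm_mul_pow_le_prod (S : Multiset Ω) {r : V.ValueGroup}
    (hS : ∀ σ ∈ S, r ≤ V.valuation σ) (k : ℕ) :
    V.valuation (S.esymm k) * r ^ (Multiset.card S - k) ≤ V.valuation S.prod := by
  classical
  unfold Multiset.esymm
  -- bound each term
  have hterm : ∀ T ∈ S.powersetCard k,
      V.valuation T.prod * r ^ (Multiset.card S - k) ≤ V.valuation S.prod := by
    intro T hT
    obtain ⟨hTS, hTcard⟩ := Multiset.mem_powersetCard.mp hT
    have hsplit : S = S - T + T := (tsub_add_cancel_of_le hTS).symm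
    have hcard : Multiset.card (S - T) = Multiset.card S - k := by
      rw [Multiset.card_sub hTS, hTcard]
    have hle : r ^ (Multiset.card S - k) ≤ V.valuation (S - T).prod := by
      rw [← hcard, map_multiset_prod, ← Multiset.card_map V.valuation (S - T)]
      refine Multiset.pow_card_le_prod fun v hv => ?_
      obtain ⟨σ, hσ, rfl⟩ := Multiset.mem_map.mp hv
      exact hS σ (Multiset.mem_of_le (Multiset.sub_le_self S T) hσ)
    calc V.valuation T.prod * r ^ (Multiset.card S - k)
        ≤ V.valuation T.prod * V.valuation (S - T).prod := mul_le_mul' le_rfl hle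
      _ = V.valuation S.prod := by
          rw [← map_mul, mul_comm, ← Multiset.prod_add, ← hsplit]
  -- ultrametric sum
  have hsum : V.valuation ((S.powersetCard k).map Multiset.prod).sum * r ^ (Multiset.card S - k) ≤
      V.valuation S.prod := by
    by_cases hr : r ^ (Multiset.card S - k) = 0
    · rw [hr, mul_zero]; exact zero_le
    · have hr0 : 0 < r ^ (Multiset.card S - k) := zero_lt_iff.mpr hr
      rw [← le_div_iff₀ hr0]
      refine valuation_sum_multiset_le V _ fun b hb => ?_
      obtain ⟨T, hT, rfl⟩ := Multiset.mem_map.mp hb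
      rw [le_div_iff₀ hr0]
      exact hterm T hT
  exact hsum

end Esymm

/-! ### The Taylor quotient `Q`: `P(a + T) = T · Q(T)` -/

section Taylor

/-- `P(X + a) = X · Q` when `P(a) = 0`. [folklore] -/
theorem X_mul_taylorQuot {P : Polynomial Ω} {a : Ω} (hPa : P.eval a = 0) :
    X * (P.comp (X + C a)).divX = P.comp (X + C a) := by
  have h := X_mul_divX_add (P.comp (X + C a))
  have h0 : (P.comp (X + C a)).coeff 0 = 0 := by
    rw [coeff_zero_eq_eval_zero, eval_comp, eval_add, eval_X, eval_C, zero_add, hPa]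
  rw [h0, map_zero, add_zero] at h
  exact h

/-- `Q(0) = P′(a)` when `P(a) = 0`. [folklore] -/
theorem eval_zero_taylorQuot {P : Polynomial Ω} {a : Ω} (hPa : P.eval a = 0) :
    ((P.comp (X + C a)).divX).eval 0 = (derivative P).eval a := by
  have h := congrArg derivative (X_mul_taylorQuot hPa)
  rw [derivative_mul, derivative_X, one_mul, derivative_comp, derivative_add, derivative_X,
    derivative_C, add_zero, one_mul] at h
  have h' := congrArg (eval 0) h
  rw [eval_add, eval_mul, eval_X, zero_mul, add_zero, eval_comp, eval_add, eval_X, eval_C,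
    zero_add] at h'
  exact h'

/-- `P′(X + a) = Q + X Q′` when `P(a) = 0`. [folklore] -/
theorem derivative_comp_eq_taylorQuot {P : Polynomial Ω} {a : Ω} (hPa : P.eval a = 0) :
    (derivative P).comp (X + C a) = (P.comp (X + C a)).divX + X * derivative ((P.comp (X + C a)).divX) := by
  have h := congrArg derivative (X_mul_taylorQuot hPa)
  rw [derivative_mul, derivative_X, one_mul, derivative_comp, derivative_add, derivative_X,
    derivative_C, add_zero, one_mul] at h
  exact h.symm

variable [IsAlgClosed Ω] [DecidableEq Ω]

/-- **`Q = ∏_{ρ ≠ a} (X − (ρ − a))`** over the roots of the monic `P` (with `a` removed once).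
[folklore] -/
theorem taylorQuot_eq_prod_roots {P : Polynomial Ω} (hPm : P.Monic) {a : Ω} (hPa : P.eval a = 0) :
    (P.comp (X + C a)).divX = (((P.roots.erase a).map fun ρ => ρ - a).map fun t => X - C t).prod := by
  have hsp : P.Splits := IsAlgClosed.splits P
  have ha : a ∈ P.roots := (mem_roots hPm.ne_zero).mpr hPa
  -- `P(X + a) = ∏ (X − (ρ − a)) = X · ∏_{ρ ≠ a} (X − (ρ − a))`
  have hcomp : P.comp (X + C a) = (P.roots.map fun ρ => X - C (ρ - a)).prod := by
    conv_lhs => rw [hsp.eq_prod_roots_of_monic hPm]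
    rw [multiset_prod_comp, Multiset.map_map]
    refine congrArg _ (Multiset.map_congr rfl fun ρ _ => ?_)
    simp only [Function.comp_apply, sub_comp, X_comp, C_comp, map_sub]
    ring
  have hsplit : (P.roots.map fun ρ => X - C (ρ - a)).prod =
      X * ((P.roots.erase a).map fun ρ => X - C (ρ - a)).prod := by
    conv_lhs => rw [← Multiset.cons_erase ha]
    rw [Multiset.map_cons, Multiset.prod_cons, sub_self, map_zero, sub_zero]
  have hX : X * (P.comp (X + C a)).divX = X * ((P.roots.erase a).map fun ρ => X - C (ρ - a)).prod := by
    rw [X_mul_taylorQuot hPa, hcomp, hsplit]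
  rw [Multiset.map_map]
  exact mul_left_cancel₀ X_ne_zero hX

/-- `|Q(0)| = |∏_{ρ ≠ a} (ρ − a)|`. [folklore] -/
theorem valuation_eval_zero_taylorQuot {P : Polynomial Ω} (hPm : P.Monic) {a : Ω}
    (hPa : P.eval a = 0) :
    V.valuation (((P.comp (X + C a)).divX).eval 0) =
      V.valuation ((P.roots.erase a).map fun ρ => ρ - a).prod := by
  rw [taylorQuot_eq_prod_roots hPm hPa, eval_multiset_prod, Multiset.map_map, Multiset.map_map,
    map_multiset_prod, map_multiset_prod, Multiset.map_map, Multiset.map_map]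
  refine congrArg _ (Multiset.map_congr rfl fun ρ _ => ?_)
  simp only [Function.comp_apply, eval_sub, eval_X, eval_C, zero_sub, Valuation.map_neg]

/-- **The Taylor coefficient bound**: if `r ≤ |ρ − a|` for every root `ρ` of `P` other than (one
copy of) `a`, then `|q_k| rᵏ ≤ |q₀| = |P′(a)|` for all `k`. [folklore] -/
theorem valuation_coeff_taylorQuot_mul_pow_le {P : Polynomial Ω} (hPm : P.Monic) {a : Ω}
    (hPa : P.eval a = 0) {r : V.ValueGroup}
    (hfar : ∀ ρ ∈ P.roots.erase a, r ≤ V.valuation (ρ - a)) (k : ℕ) :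
    V.valuation (((P.comp (X + C a)).divX).coeff k) * r ^ k ≤ V.valuation ((derivative P).eval a) := by
  classical
  set R' : Multiset Ω := (P.roots.erase a).map fun ρ => ρ - a with hR'
  have hR'far : ∀ σ ∈ R', r ≤ V.valuation σ := by
    intro σ hσ
    obtain ⟨ρ, hρ, rfl⟩ := Multiset.mem_map.mp hσ
    exact hfar ρ hρ
  have hQ : (P.comp (X + C a)).divX = (R'.map fun t => X - C t).prod := taylorQuot_eq_prod_roots hPm hPa
  have hq0 : V.valuation ((derivative P).eval a) = V.valuation R'.prod := by
    rw [← eval_zero_taylorQuot hPa, valuation_eval_zero_taylorQuot V hPm hPa]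
  rw [hq0]
  by_cases hk : k ≤ Multiset.card R'
  · -- Vieta: `q_k = ± e_{n−k}(R')`
    rw [hQ, Multiset.prod_X_sub_C_coeff R' hk, map_mul, map_pow, Valuation.map_neg, map_one,
      one_pow, one_mul]
    have h := valuation_esymm_mul_pow_le_prod V R' hR'far (Multiset.card R' - k)
    rwa [Nat.sub_sub_self hk] at h
  · -- beyond the degree
    have hdeg : ((P.comp (X + C a)).divX).natDegree < k := by
      rw [hQ, natDegree_multiset_prod_X_sub_C_eq_card]
      omega
    rw [coeff_eq_zero_of_natDegree_lt hdeg, map_zero, zero_mul]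
    exact zero_le

end Taylor

/-! ### The disc: unit form of `P′(x)` and the coefficients of `H` -/

section Disc

variable (m : Subfield Ω)

/-- Polynomials with coefficients in the subfield `m` are closed under composition. [folklore] -/
theorem coeff_comp_mem_subfield {P R : Polynomial Ω} (hP : ∀ i, P.coeff i ∈ m)
    (hR : ∀ i, R.coeff i ∈ m) (i : ℕ) : (P.comp R).coeff i ∈ m := by
  have hlP : P ∈ Polynomial.lifts (algebraMap m Ω) :=
    (lifts_iff_coeff_lifts P).mpr fun k => ⟨⟨P.coeff k, hP k⟩, rfl⟩
  have hlR : R ∈ Polynomial.lifts (algebraMap m Ω) :=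
    (lifts_iff_coeff_lifts R).mpr fun k => ⟨⟨R.coeff k, hR k⟩, rfl⟩
  obtain ⟨P', hP'⟩ := (mem_lifts P).mp hlP
  obtain ⟨R', hR'⟩ := (mem_lifts R).mp hlR
  have : P.comp R = (P'.comp R').map (algebraMap m Ω) := by rw [Polynomial.map_comp, hP', hR']
  rw [this, coeff_map]
  exact Subtype.mem _

/-- The Taylor quotient of a polynomial over `m` at `a ∈ m` has coefficients in `m`. [folklore] -/
theorem coeff_taylorQuot_mem {P : Polynomial Ω} (hP : ∀ i, P.coeff i ∈ m) {a : Ω} (ha : a ∈ m)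
    (k : ℕ) : ((P.comp (X + C a)).divX).coeff k ∈ m := by
  rw [coeff_divX]
  refine coeff_comp_mem_subfield m hP (fun i => ?_) _
  rw [coeff_add, coeff_X, coeff_C]
  split_ifs <;> simp [ha, m.one_mem, m.zero_mem, m.add_mem]

variable [IsAlgClosed Ω] [DecidableEq Ω]

set_option maxHeartbeats 1600000 in
/-- **The unit form of `P′(x)` and the coefficients of the Hensel polynomial in the disc chart.**
Data: `P` monic with coefficients in `m`, `a ∈ m` a simple root (`P(a) = 0`, `P′(a) ≠ 0`),
`c ∈ m`, `c ≠ 0`, every root `ρ` of `P` other than (one copy of) `a` with `|c| < |ρ − a|`, and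
`x` with `|x − a| ≤ |c|`; `x′ = (x − a)/c`, `m° = O_V ∩ m`. Then there is a unit form `U` over
`m` (`U(0) = 1`, higher coefficients in `m` of value `< 1`) with `P′(x) = P′(a) · U(x′)`, and
for every `u ∈ m°[x′]`, `u ≠ 0`, divisible by `U(x′)` in `m°[x′]`, all coefficients of
`H = discHenselPoly P c x` lie in `m°[x′][1/u]`. [folklore] -/
theorem exists_unitForm_derivative_and_coeff_mem {P : Polynomial Ω} (hPm : P.Monic)
    (hP : ∀ i, P.coeff i ∈ m) {a c x : Ω} (ha : a ∈ m) (hc : c ∈ m) (hc0 : c ≠ 0)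
    (hPa : P.eval a = 0) (hPa' : (derivative P).eval a ≠ 0)
    (hfar : ∀ ρ ∈ P.roots.erase a, V.valuation c < V.valuation (ρ - a))
    (hxa : V.valuation (x - a) ≤ V.valuation c) :
    ∃ U : Polynomial Ω, (∀ i, U.coeff i ∈ m) ∧ U.coeff 0 = 1 ∧
      (∀ i, 1 ≤ i → V.valuation (U.coeff i) < 1) ∧
      (derivative P).eval x = (derivative P).eval a * U.eval ((x - a) / c) ∧
      ∀ {u : Ω} (hu : u ∈ Algebra.adjoin (V.toSubring ⊓ m.toSubring : Subring Ω)
        ({(x - a) / c} : Set Ω)), u ≠ 0 →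
        (∃ w ∈ Algebra.adjoin (V.toSubring ⊓ m.toSubring : Subring Ω) ({(x - a) / c} : Set Ω),
          U.eval ((x - a) / c) * w = u) →
        ∀ j, (discHenselPoly P c x).coeff j ∈
          locAway (Algebra.adjoin (V.toSubring ⊓ m.toSubring : Subring Ω) ({(x - a) / c} : Set Ω))
            u hu := by
  classical
  set Om : Subring Ω := V.toSubring ⊓ m.toSubring with hOm
  set x' : Ω := (x - a) / c with hx'
  set S := Algebra.adjoin Om ({x'} : Set Ω) with hS
  set Q := (P.comp (X + C a)).divX with hQdef
  set q₀ : Ω := (derivative P).eval a with hq₀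
  set Qc : Polynomial Ω := Q.comp (C c * X) with hQc
  have hxeq : x = a + c * x' := by rw [hx', mul_div_cancel₀ _ hc0]; ring
  have hx'V : x' ∈ V := by
    rw [← V.valuation_le_one_iff, hx', map_div₀]
    exact div_le_one_of_le₀ hxa zero_le
  -- coefficients of `Q`, `Qc`
  have hQm : ∀ k, Q.coeff k ∈ m := coeff_taylorQuot_mem m hP ha
  have hQc_coeff : ∀ k, Qc.coeff k = Q.coeff k * c ^ k := fun k => by
    rw [hQc, comp_C_mul_X_coeff]
  -- the Taylor bound with `r = |c|`, and strictly for `k ≥ 1`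
  have hbound : ∀ k, V.valuation (Qc.coeff k) ≤ V.valuation q₀ := fun k => by
    rw [hQc_coeff, map_mul, map_pow]
    exact valuation_coeff_taylorQuot_mul_pow_le V hPm hPa (fun ρ hρ => (hfar ρ hρ).le) k
  have hq₀0 : q₀ ≠ 0 := hPa'
  have hvq₀ : V.valuation q₀ ≠ 0 := by rwa [Ne, map_eq_zero]
  have hstrict : ∀ k, 1 ≤ k → V.valuation (Qc.coeff k) < V.valuation q₀ := by
    intro k hk
    by_cases hne : P.roots.erase a = 0
    · -- `P` linear: `Q` is constant
      have hQ1 : Q = 1 := by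
        rw [hQdef, taylorQuot_eq_prod_roots hPm hPa, hne, Multiset.map_zero, Multiset.map_zero,
          Multiset.prod_zero]
      rw [hQc_coeff, hQ1, coeff_one]
      have : (k = 0) = False := by simp only [eq_iff_iff, iff_false]; omega
      simp only [this, if_false, zero_mul, map_zero]
      exact zero_lt_iff.mpr hvq₀
    · -- a minimal root distance `r' > |c|`
      obtain ⟨ρ₀, hρ₀, hmin⟩ := Multiset.exists_min_image (fun ρ => V.valuation (ρ - a)) hne
      set r' := V.valuation (ρ₀ - a) with hr'
      have hcr' : V.valuation c < r' := hfar ρ₀ hρ₀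
      have hle : V.valuation (Q.coeff k) * r' ^ k ≤ V.valuation q₀ :=
        valuation_coeff_taylorQuot_mul_pow_le V hPm hPa (fun ρ hρ => hmin ρ hρ) k
      rw [hQc_coeff, map_mul, map_pow]
      by_cases hq : V.valuation (Q.coeff k) = 0
      · rw [hq, zero_mul]; exact zero_lt_iff.mpr hvq₀
      · calc V.valuation (Q.coeff k) * V.valuation c ^ k
            < V.valuation (Q.coeff k) * r' ^ k := by
              refine mul_lt_mul_of_pos_left ?_ (zero_lt_iff.mpr hq)
              exact pow_lt_pow_left₀ hcr' zero_le (by omega)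
          _ ≤ V.valuation q₀ := hle
  have hQc0 : Qc.coeff 0 = q₀ := by
    rw [hQc_coeff, pow_zero, mul_one, coeff_zero_eq_eval_zero, hQdef, eval_zero_taylorQuot hPa]
  have hq₀m : q₀ ∈ m := by
    rw [← hQc0, hQc_coeff]; exact m.mul_mem (hQm 0) (m.pow_mem hc 0)
  have hQcm : ∀ k, Qc.coeff k ∈ m := fun k => by
    rw [hQc_coeff]; exact m.mul_mem (hQm k) (m.pow_mem hc k)
  ------------------------------------------------------------------
  -- the unit form `U = (Qc + X Qc′)/q₀`
  ------------------------------------------------------------------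
  set U : Polynomial Ω := C q₀⁻¹ * (Qc + X * derivative Qc) with hU
  have hUcoeff : ∀ k, U.coeff k = q₀⁻¹ * ((k + 1 : ℕ) * Qc.coeff k) := by
    intro k
    rw [hU, coeff_C_mul, coeff_add]
    congr 1
    rcases k with _ | k
    · simp
    · rw [coeff_X_mul, coeff_derivative]
      push_cast
      ring
  have hUm : ∀ k, U.coeff k ∈ m := fun k => by
    rw [hUcoeff]
    exact m.mul_mem (m.inv_mem hq₀m) (m.mul_mem (by exact_mod_cast natCast_mem m (k + 1)) (hQcm k))
  have hU0 : U.coeff 0 = 1 := by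
    rw [hUcoeff, hQc0]; simp [hq₀0]
  have hUlt : ∀ k, 1 ≤ k → V.valuation (U.coeff k) < 1 := by
    intro k hk
    rw [hUcoeff, map_mul, map_inv₀, map_mul]
    have h1 : V.valuation ((k + 1 : ℕ) : Ω) ≤ 1 := (V.valuation_le_one_iff _).mpr (natCast_mem V _)
    calc (V.valuation q₀)⁻¹ * (V.valuation ((k + 1 : ℕ) : Ω) * V.valuation (Qc.coeff k))
        ≤ (V.valuation q₀)⁻¹ * (1 * V.valuation (Qc.coeff k)) :=
          mul_le_mul' le_rfl (mul_le_mul' h1 le_rfl)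
      _ = V.valuation (Qc.coeff k) / V.valuation q₀ := by rw [one_mul, div_eq_inv_mul]
      _ < 1 := (div_lt_one₀ (zero_lt_iff.mpr hvq₀)).mpr (hstrict k hk)
  -- `P′(x) = q₀ U(x′)`
  have hderiv : (derivative P).eval x = q₀ * U.eval x' := by
    have h1 : (derivative P).eval x = ((derivative P).comp (X + C a)).eval (c * x') := by
      rw [eval_comp, eval_add, eval_X, eval_C, hxeq]; ring_nf
    have e1 : Qc.eval x' = Q.eval (c * x') := by rw [hQc, eval_comp, eval_mul, eval_C, eval_X]
    have e2 : (derivative Qc).eval x' = c * (derivative Q).eval (c * x') := by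
      rw [hQc, derivative_comp]
      simp only [derivative_mul, derivative_C, zero_mul, derivative_X, mul_one, zero_add, eval_mul,
        eval_C, eval_comp, eval_X]
    rw [h1, derivative_comp_eq_taylorQuot hPa, ← hQdef, eval_add, eval_mul, eval_X, hU, eval_mul,
      eval_C, eval_add, eval_mul, eval_X, e1, e2]
    field_simp
  refine ⟨U, hUm, hU0, hUlt, hderiv, ?_⟩
  ------------------------------------------------------------------
  -- the coefficients of `H`
  ------------------------------------------------------------------
  intro u hu hu0 hdvd j
  obtain ⟨w, hw, hUw⟩ := hdvd
  have hUx0 : U.eval x' ≠ 0 := fun h0 => hu0 (by rw [← hUw, h0, zero_mul])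
  -- `Q̃ = Qc/q₀` has coefficients in `m°`
  set Qt : Polynomial Ω := C q₀⁻¹ * Qc with hQt
  have hQtOm : ∀ k, Qt.coeff k ∈ Om := by
    intro k
    rw [hQt, coeff_C_mul, hOm, Subring.mem_inf]
    refine ⟨?_, m.mul_mem (m.inv_mem hq₀m) (hQcm k)⟩
    rw [ValuationSubring.mem_toSubring, ← V.valuation_le_one_iff, map_mul, map_inv₀,
      ← div_eq_inv_mul]
    exact div_le_one_of_le₀ (hbound k) zero_le
  -- the identity `H · U(x′) = −(W · Q̃(W))`, `W = x′ − X`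
  set W : Polynomial Ω := C x' - X with hW
  have hcomp : P.comp (C x - C c * X) = C c * W * Qc.comp W := by
    have h1 : C x - C c * X = (X + C a).comp (C c * W) := by
      rw [add_comp, X_comp, C_comp, hW, hxeq, map_add, map_mul]; ring
    have h2 : (C c * X).comp W = C c * W := by rw [mul_comp, C_comp, X_comp]
    rw [h1, ← comp_assoc, ← X_mul_taylorQuot hPa, ← hQdef, mul_comp, X_comp, hQc, comp_assoc, h2]
  have hH : discHenselPoly P c x * C (U.eval x') = -(W * Qt.comp W) := by
    rw [discHenselPoly_def, hcomp, hderiv, hQt, mul_comp, C_comp]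
    calc C c * W * Qc.comp W * C (-c * (q₀ * U.eval x'))⁻¹ * C (U.eval x')
        = (C c * C (-c * (q₀ * U.eval x'))⁻¹ * C (U.eval x')) * (W * Qc.comp W) := by ring
      _ = C (-(q₀⁻¹)) * (W * Qc.comp W) := by
          rw [← map_mul, ← map_mul]
          congr 1
          field_simp
      _ = -(W * (C q₀⁻¹ * Qc.comp W)) := by rw [map_neg]; ring
  -- `W · Q̃(W)` has coefficients in `S = m°[x′]`
  have hWS : ∀ k, W.coeff k ∈ S := by
    intro k
    rw [hW, coeff_sub, coeff_C, coeff_X]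
    refine S.sub_mem ?_ ?_
    · split_ifs
      · exact Algebra.subset_adjoin rfl
      · exact S.zero_mem
    · split_ifs
      · exact S.one_mem
      · exact S.zero_mem
  have hQtS : ∀ k, Qt.coeff k ∈ S := fun k => S.algebraMap_mem ⟨Qt.coeff k, hQtOm k⟩
  have hlift : ∀ R : Polynomial Ω, (∀ k, R.coeff k ∈ S) →
      ∃ R' : Polynomial S, R'.map (algebraMap S Ω) = R := fun R hR =>
    (mem_lifts R).mp ((lifts_iff_coeff_lifts R).mpr fun k => ⟨⟨R.coeff k, hR k⟩, rfl⟩)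
  obtain ⟨WS, hWS'⟩ := hlift W hWS
  obtain ⟨QtS, hQtS'⟩ := hlift Qt hQtS
  have hmemS : ∀ k, (-(W * Qt.comp W)).coeff k ∈ S := by
    intro k
    have : -(W * Qt.comp W) = (-(WS * QtS.comp WS)).map (algebraMap S Ω) := by
      rw [Polynomial.map_neg, Polynomial.map_mul, Polynomial.map_comp, hWS', hQtS']
    rw [this, coeff_map]
    exact Subtype.mem _
  -- conclude
  have hj : (discHenselPoly P c x).coeff j * U.eval x' ∈ S := by
    have := congrArg (fun p : Polynomial Ω => p.coeff j) hH
    simp only [coeff_mul_C] at this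
    rw [this]
    exact hmemS j
  have hrepr : (discHenselPoly P c x).coeff j =
      ((discHenselPoly P c x).coeff j * U.eval x') * w * u⁻¹ := by
    rw [mul_assoc _ (U.eval x') w, hUw, mul_assoc, mul_inv_cancel₀ hu0, mul_one]
  rw [hrepr]
  exact (locAway S u hu).mul_mem (le_locAway (S.mul_mem hj hw)) (inv_mem_locAway hu0)

end Disc

end Literature.AlgebraicGeometry.Resolution

end
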